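import Summits.Langlands.Langlands.Theses.WallWindowSplit

/-!
# Route WallWindowSplit — Assembly

The assembly item (stmt-Langlands-26622) of the child route `WallWindowSplit` (decomp-langlands lens-2 gen 16; refines the declared residual
R = `MinusculeHodgeTypeSplit.NonMinusculeWallAutomorphy`, stmt-Langlands-27007) for the Langlands summit:
`WallKroneckerWindowTransport → WallExteriorSquareWindowTransport → WindowlessWallAutomorphy → NonMinusculeWallFrame → Langlands`.

This is literally the type of the route file's sorry-free deciding theorem `Summit.Langlands.Langlands.Theses.WallWindowSplit.closes`
(FRAME reduces `Langlands` to R; excluded middle on the two inlined window dials dispatches to KT, EXT or RES).  Nothing here proves `Langlands`: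
the assembly records only that the four ledger items of the route, taken together, imply the summit statement.
-/

set_option linter.dupNamespace false -- project-wide option (lakefile weak.linter.dupNamespace); `Summit.Langlands.Langlands` is the mandated namespace

namespace Summit.Langlands.Langlands.Theorems

/-- **Assembly of route WallWindowSplit** (stmt-Langlands-26622): `KT → EXT → RES → FRAME → Langlands`.  Proof: unfold `Assembly` and apply the
route's deciding theorem `Theses.WallWindowSplit.closes`. -/
theorem wallWindowSplit_assembly_proof :
    Summit.Langlands.Langlands.Theses.WallWindowSplit.Assembly := by
  unfold Summit.Langlands.Langlands.Theses.WallWindowSplit.Assembly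
  exact Summit.Langlands.Langlands.Theses.WallWindowSplit.closes

end Summit.Langlands.Langlands.Theorems
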